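import Literature.NumberTheory.Automorphic.WhittakerBiEquivariantSupportLevel
import Literature.NumberTheory.Automorphic.TorusIntegrandThinSupport
import HarnessLib

/-!
# The bad-place part of a PAIR of Whittaker functions on the thin set is a phase times its stripped value

Topic `NumberTheory/Automorphic`; namespace `Literature.NumberTheory.Automorphic`. Theorems only (no
definition, no named fact). The pointwise device behind "the local Rankin–Selberg integral of suitable
data at a bad non-archimedean place is a non-zero constant" (Jacquet–Piatetski-Shapiro–Shalika (1983),
(2.7), p. 393; used for Corollaire (i)(b) of Mœglin–Waldspurger (1989) via Cogdell (2004), §4.1–§4.2),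
for a PAIR `(W, W')` of functions on `GL_{n+1}(𝔸_K)` at a finite place `v`:

* `W` is left `ψ_v`-equivariant under `ι_v(N_{n+1}(K_v))` and spread bi-equivariant at `v`
  (`IsSpreadWhittakerAt v ψ t M W`, parameters as in the support theorem);
* `W'` is left `ψ_v`-equivariant under `ι_v(N_{n+1}(K_v))` and right invariant under `ι_v(K(𝔭_v^M))`.

No left equivariance under the archimedean or the other finite unipotents is required (so the
statements apply to the finite Whittaker functions `g ↦ Λ₀(g_f · T)` of a finite component, which do
not see `g_∞`). Then at every `g` whose `v`-component has last row `≡ e_{n+1} (mod 𝔭_v^{m₀})`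
(`exp(-m₀)|t₀| ≤ exp(-M)|t_n|`) and `W(g) ≠ 0`:

  `W(g) = ψ_{v,N}(u) W(g^{(v)})`, `W'(g) = ψ_{v,N}(u) W'(g^{(v)})`, hence
  `W(g) \overline{W'(g)} = W(g^{(v)}) \overline{W'(g^{(v)})}`

with `g^{(v)} = g ι_v(g_v)⁻¹` the element with the `v`-component stripped
(`apply_mul_conj_apply_eq_stripped`): by the level form of the support theorem
(`WhittakerSupport.exists_eq_unipotent_mul_level_of_lastRow`) `g_v = u k` with `k ∈ K(𝔭_v^M)` invisible
to the `v`-slot of `W`, and `k` is invisible to `W'` by its level. Iterating over a finite set `T` of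
places (`exists_stripped_apply_mul_conj_apply_eq`): `W W̄'(g) = W W̄'(g')` for a `g'` with trivial
components at `T`, the components off `T` and the archimedean component unchanged.

## References

* H. Jacquet, I. I. Piatetski-Shapiro, J. A. Shalika, *Rankin–Selberg convolutions*, Amer. J. Math.
  105 (1983), §2, (2.7), p. 393 [JacquetPiatetskiShapiroShalika1983].
* C. Mœglin, J.-L. Waldspurger, *Le spectre résiduel de GL(n)*, Ann. Sci. ÉNS 22 (1989), Appendice,
  p. 667 [MoeglinWaldspurger1989].
-/

noncomputable section

open MeasureTheory NumberField IsDedekindDomain Matrix Set WithZero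
open scoped MatrixGroups ComplexConjugate

namespace Literature.NumberTheory.Automorphic

/-! ### The `v`-slot of a function with the weak (local) left equivariance -/

section Slot

open ValuativeRel

variable {N : ℕ} {K : Type} [Field K] [NumberField K] (v : HeightOneSpectrum (𝓞 K))

/-- **The `v`-slot `h ↦ W(g' ι_v(h))` is a spread bi-equivariant Whittaker function on `GL_N(K_v)`**
as soon as `W` is left `ψ_v`-equivariant under `ι_v(N_N(K_v))` only, spread bi-equivariant at `v`, and
`g'` has trivial `v`-component (a variant of `isSpreadWhittaker_ofLocal` with the weaker left
hypothesis). [folklore] -/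
theorem isSpreadWhittaker_ofLocal_of_local {ψ : AddChar (AdeleRing (𝓞 K) K) Circle}
    {t : Fin N → (v.adicCompletion K)ˣ} {M : ℤ} {W : GL (Fin N) (AdeleRing (𝓞 K) K) → ℂ}
    (hWN : ∀ (u : GL (Fin N) (v.adicCompletion K)) (hu : u ∈ upperUnitriangular (Fin N) (v.adicCompletion K))
      (g : GL (Fin N) (AdeleRing (𝓞 K) K)),
      W (GLn.ofLocal N K v u * g) = whittakerCharFun (ψ.adicComponent v) ⟨u, hu⟩ * W g)
    (hW : IsSpreadWhittakerAt v ψ t M W) {g' : GL (Fin N) (AdeleRing (𝓞 K) K)}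
    (hg' : localComponent v g' = 1) :
    WhittakerSupport.IsSpreadWhittaker (ψ.adicComponent v) t M (fun h => W (g' * GLn.ofLocal N K v h)) := by
  refine ⟨fun u hu h => ?_, fun u hu hbd h => ?_, fun κ hκ hκ' h => ?_⟩
  · rw [map_mul, ← mul_assoc, ← GLn.ofLocal_mul_eq_mul_ofLocal_of_toLocal_eq_one u hg', mul_assoc]
    exact hWN u hu (g' * GLn.ofLocal N K v h)
  · rw [map_mul, ← mul_assoc]
    exact hW.right u hu hbd _
  · rw [map_mul, ← mul_assoc]
    exact hW.level κ hκ hκ' _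

/-- **The `v`-slot of a function left `ψ_v`-equivariant under `ι_v(N_N(K_v))` is left
`ψ_v`-equivariant** (for `g'` of trivial `v`-component). [folklore] -/
theorem slot_left_of_local {ψ : AddChar (AdeleRing (𝓞 K) K) Circle} {W : GL (Fin N) (AdeleRing (𝓞 K) K) → ℂ}
    (hWN : ∀ (u : GL (Fin N) (v.adicCompletion K)) (hu : u ∈ upperUnitriangular (Fin N) (v.adicCompletion K))
      (g : GL (Fin N) (AdeleRing (𝓞 K) K)),
      W (GLn.ofLocal N K v u * g) = whittakerCharFun (ψ.adicComponent v) ⟨u, hu⟩ * W g)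
    {g' : GL (Fin N) (AdeleRing (𝓞 K) K)} (hg' : localComponent v g' = 1) :
    ∀ (u : GL (Fin N) (v.adicCompletion K)) (hu : u ∈ upperUnitriangular (Fin N) (v.adicCompletion K))
      (h : GL (Fin N) (v.adicCompletion K)),
      W (g' * GLn.ofLocal N K v (u * h)) = whittakerCharFun (ψ.adicComponent v) ⟨u, hu⟩ * W (g' * GLn.ofLocal N K v h) := by
  intro u hu h
  rw [map_mul, ← mul_assoc, ← GLn.ofLocal_mul_eq_mul_ofLocal_of_toLocal_eq_one u hg', mul_assoc]
  exact hWN u hu (g' * GLn.ofLocal N K v h)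

/-- `g = g^{(v)} ι_v(g_v)` with `g^{(v)} = g ι_v(g_v)⁻¹`. [folklore] -/
theorem stripped_mul_ofLocal_localComponent (g : GL (Fin N) (AdeleRing (𝓞 K) K)) :
    g * GLn.ofLocal N K v (localComponent v g)⁻¹ * GLn.ofLocal N K v (localComponent v g) = g := by
  rw [mul_assoc, ← map_mul, inv_mul_cancel, map_one, mul_one]

/-- A unitary phase `ψ_N(u)` disappears from `W W̄'`. [folklore] -/
theorem whittakerCharFun_mul_mul_conj_mul (ψv : AddChar (v.adicCompletion K) Circle)
    (u : ↥(upperUnitriangular (Fin N) (v.adicCompletion K))) (a b : ℂ) :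
    whittakerCharFun ψv u * a * conj (whittakerCharFun ψv u * b) = a * conj b := by
  have hz : whittakerCharFun ψv u * conj (whittakerCharFun ψv u) = 1 := by
    rw [whittakerCharFun_apply, Complex.mul_conj, Complex.normSq_eq_norm_sq, Circle.norm_coe, one_pow,
      Complex.ofReal_one]
  rw [map_mul]
  calc whittakerCharFun ψv u * a * (conj (whittakerCharFun ψv u) * conj b) =
      (whittakerCharFun ψv u * conj (whittakerCharFun ψv u)) * (a * conj b) := by ring
    _ = a * conj b := by rw [hz, one_mul]

end Slot

/-! ### One place -/

section OnePlace

open ValuativeRel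

variable {n : ℕ} {K : Type} [Field K] [NumberField K] {v : HeightOneSpectrum (𝓞 K)}

/-- **At a thin point the pair `(W, W̄')` takes its stripped value** (one place). Let `W` be left
`ψ_v`-equivariant under `ι_v(N_{n+1}(K_v))` and spread bi-equivariant at `v` for parameters `t`, `M`
with `ψ_v` non-trivial somewhere on `{|x| ≤ exp(1 - c₀)}`, `M ≥ 1`, decreasing `|t_i|`, gaps
`exp(M - c₀)|t_{i+1}| ≤ |t_i|` and `exp(-m₀)|t₀| ≤ exp(-M)|t_n|`; let `W'` be left `ψ_v`-equivariant under
`ι_v(N_{n+1}(K_v))` and right invariant under `ι_v(K(𝔭_v^M))`. If the `v`-component of `g` has last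
row `≡ e_{n+1} (mod 𝔭_v^{m₀})` and `W(g) ≠ 0`, then with `g^{(v)} = g ι_v(g_v)⁻¹` there is a unipotent
`u ∈ N_{n+1}(K_v)` with `W(g) = ψ_{v,N}(u) W(g^{(v)})` and `W'(g) = ψ_{v,N}(u) W'(g^{(v)})`; in particular
`W(g) \overline{W'(g)} = W(g^{(v)}) \overline{W'(g^{(v)})}` and `W(g^{(v)}) ≠ 0`.
[cite: JacquetPiatetskiShapiroShalika1983, §2 (2.7), p. 393] -/
theorem apply_mul_conj_apply_eq_stripped
    {ψ : AddChar (AdeleRing (𝓞 K) K) Circle} {W W' : GL (Fin (n + 1)) (AdeleRing (𝓞 K) K) → ℂ}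
    (hWN : ∀ (u : GL (Fin (n + 1)) (v.adicCompletion K)) (hu : u ∈ upperUnitriangular (Fin (n + 1)) (v.adicCompletion K))
      (g : GL (Fin (n + 1)) (AdeleRing (𝓞 K) K)),
      W (GLn.ofLocal (n + 1) K v u * g) = whittakerCharFun (ψ.adicComponent v) ⟨u, hu⟩ * W g)
    (hW'N : ∀ (u : GL (Fin (n + 1)) (v.adicCompletion K)) (hu : u ∈ upperUnitriangular (Fin (n + 1)) (v.adicCompletion K))
      (g : GL (Fin (n + 1)) (AdeleRing (𝓞 K) K)),
      W' (GLn.ofLocal (n + 1) K v u * g) = whittakerCharFun (ψ.adicComponent v) ⟨u, hu⟩ * W' g)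
    {t : Fin (n + 1) → (v.adicCompletion K)ˣ} {M c₀ : ℤ} (hW : IsSpreadWhittakerAt v ψ t M W)
    (hψv : ∃ x : v.adicCompletion K, Valued.v x ≤ exp (1 - c₀) ∧ ψ.adicComponent v x ≠ 1) (hM₁ : 1 ≤ M)
    (hmono : ∀ i j : Fin (n + 1), i ≤ j → Valued.v (t j : v.adicCompletion K) ≤ Valued.v (t i : v.adicCompletion K))
    (hgap : ∀ i j : Fin (n + 1), (i : ℕ) + 1 = j →
      exp (M - c₀) * Valued.v (t j : v.adicCompletion K) ≤ Valued.v (t i : v.adicCompletion K))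
    {m₀ : ℤ} (hmt : exp (-m₀) * Valued.v (t 0 : v.adicCompletion K) ≤ exp (-M) * Valued.v (t (Fin.last n) : v.adicCompletion K))
    (hW'K : ∀ k ∈ valuedCongruenceSubgroup (Fin (n + 1)) (exp (-M)), ∀ g : GL (Fin (n + 1)) (AdeleRing (𝓞 K) K),
      W' (g * GLn.ofLocal (n + 1) K v k) = W' g)
    {g : GL (Fin (n + 1)) (AdeleRing (𝓞 K) K)}
    (hlast : ∀ j : Fin (n + 1),
      Valued.v (((localComponent v g : GL (Fin (n + 1)) (v.adicCompletion K)) :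
          Matrix (Fin (n + 1)) (Fin (n + 1)) (v.adicCompletion K)) (Fin.last n) j -
        if Fin.last n = j then 1 else 0) ≤ exp (-m₀))
    (hne : W g ≠ 0) :
    ∃ (u : GL (Fin (n + 1)) (v.adicCompletion K)) (hu : u ∈ upperUnitriangular (Fin (n + 1)) (v.adicCompletion K)),
      W g = whittakerCharFun (ψ.adicComponent v) ⟨u, hu⟩ * W (g * GLn.ofLocal (n + 1) K v (localComponent v g)⁻¹) ∧
      W' g = whittakerCharFun (ψ.adicComponent v) ⟨u, hu⟩ * W' (g * GLn.ofLocal (n + 1) K v (localComponent v g)⁻¹) ∧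
      W g * conj (W' g) = W (g * GLn.ofLocal (n + 1) K v (localComponent v g)⁻¹) *
        conj (W' (g * GLn.ofLocal (n + 1) K v (localComponent v g)⁻¹)) ∧
      W (g * GLn.ofLocal (n + 1) K v (localComponent v g)⁻¹) ≠ 0 := by
  set gv : GL (Fin (n + 1)) (v.adicCompletion K) := localComponent v g with hgv
  set g' : GL (Fin (n + 1)) (AdeleRing (𝓞 K) K) := g * GLn.ofLocal (n + 1) K v gv⁻¹ with hg'
  have hg'1 : localComponent v g' = 1 := localComponent_mul_ofLocal_inv g
  have hgeq : g' * GLn.ofLocal (n + 1) K v gv = g := stripped_mul_ofLocal_localComponent v g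
  -- the two slots
  set ω : GL (Fin (n + 1)) (v.adicCompletion K) → ℂ := fun h => W (g' * GLn.ofLocal (n + 1) K v h) with hω
  set ω' : GL (Fin (n + 1)) (v.adicCompletion K) → ℂ := fun h => W' (g' * GLn.ofLocal (n + 1) K v h) with hω'
  have hωS : WhittakerSupport.IsSpreadWhittaker (ψ.adicComponent v) t M ω := isSpreadWhittaker_ofLocal_of_local v hWN hW hg'1
  have hω'left := slot_left_of_local v hW'N hg'1
  have hωg : ω gv = W g := by simp only [hω]; rw [hgeq]
  have hω'g : ω' gv = W' g := by simp only [hω']; rw [hgeq]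
  have hne' : ω gv ≠ 0 := by rwa [hωg]
  -- the level form of the support theorem on the slot of `W`
  obtain ⟨u, hu, k, hk, hkω, hgvk⟩ :=
    WhittakerSupport.exists_eq_unipotent_mul_level_of_lastRow (ψ.adicComponent v) hψv hM₁ hmono hgap hωS hmt hlast hne'
  have hkω' : ∀ y : GL (Fin (n + 1)) (v.adicCompletion K), ω' (y * k) = ω' y := fun y => by
    simp only [hω']
    rw [map_mul, ← mul_assoc, hW'K k hk]
  have h1 : ω gv = whittakerCharFun (ψ.adicComponent v) ⟨u, hu⟩ * ω 1 :=
    WhittakerSupport.apply_eq_whittakerCharFun_mul_apply_one_of_eq_mul (ψ.adicComponent v) hωS.left hu hkω hgvk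
  have h2 : ω' gv = whittakerCharFun (ψ.adicComponent v) ⟨u, hu⟩ * ω' 1 :=
    WhittakerSupport.apply_eq_whittakerCharFun_mul_apply_one_of_eq_mul (ψ.adicComponent v) hω'left hu hkω' hgvk
  have hω1 : ω 1 = W g' := by simp only [hω]; rw [map_one, mul_one]
  have hω'1 : ω' 1 = W' g' := by simp only [hω']; rw [map_one, mul_one]
  rw [hωg, hω1] at h1
  rw [hω'g, hω'1] at h2
  refine ⟨u, hu, h1, h2, ?_, ?_⟩
  · rw [h1, h2, whittakerCharFun_mul_mul_conj_mul]
  · intro h0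
    rw [h0, mul_zero] at h1
    exact hne h1

end OnePlace

/-! ### Finitely many places -/

section ManyPlaces

open ValuativeRel

variable {n : ℕ} {K : Type} [Field K] [NumberField K]

/-- Stripping the `v`-component does not change the other components. [folklore] -/
theorem localComponent_stripped_of_ne {v w : HeightOneSpectrum (𝓞 K)} (hwv : w ≠ v)
    (g : GL (Fin (n + 1)) (AdeleRing (𝓞 K) K)) :
    localComponent w (g * GLn.ofLocal (n + 1) K v (localComponent v g)⁻¹) = localComponent w g := by
  have h1 : localComponent w (GLn.ofLocal (n + 1) K v (localComponent v g)⁻¹) = 1 := GLn.toLocal_ofLocal_of_ne hwv _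
  have h2 : localComponent w (g * GLn.ofLocal (n + 1) K v (localComponent v g)⁻¹) =
      localComponent w g * localComponent w (GLn.ofLocal (n + 1) K v (localComponent v g)⁻¹) := map_mul _ _ _
  rw [h2, h1, mul_one]

/-- Stripping the `v`-component multiplies the finite part on the right by `(1, ι_v(g_v)⁻¹)`. [folklore] -/
theorem sndHom_stripped (v : HeightOneSpectrum (𝓞 K)) (g : GL (Fin (n + 1)) (AdeleRing (𝓞 K) K)) :
    GLn.sndHom (n + 1) K (g * GLn.ofLocal (n + 1) K v (localComponent v g)⁻¹) =
      GLn.sndHom (n + 1) K g * GLn.sndHom (n + 1) K (GLn.ofLocal (n + 1) K v (localComponent v g)⁻¹) :=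
  map_mul _ _ _

/-- **At a point thin at every place of `T` the pair `(W, W̄')` takes its `T`-stripped value.** Let
`T` be a finite set of finite places and, for every `v ∈ T`, the hypotheses of
`apply_mul_conj_apply_eq_stripped` (left `ψ_v`-equivariance of `W` and `W'` under `ι_v(N(K_v))`,
spread bi-equivariance of `W` at `v` with parameters `t_v, M_v, c₀_v, m₀_v`, level `K(𝔭_v^{M_v})` of
`W'`). If the `v`-component of `g` has last row `≡ e_{n+1} (mod 𝔭_v^{m₀_v})` for every `v ∈ T` and
`W(g) ≠ 0`, there is `g'` with trivial `v`-component for `v ∈ T`, the same `w`-component as `g` for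
`w ∉ T`, finite part `g_f · y` with `y` in the group generated by the
`(1, ι_v(h))`, `v ∈ T`, such that `W(g) \overline{W'(g)} = W(g') \overline{W'(g')}` and `W(g') ≠ 0`.
[cite: JacquetPiatetskiShapiroShalika1983, §2 (2.7), p. 393] -/
theorem exists_stripped_apply_mul_conj_apply_eq
    {ψ : AddChar (AdeleRing (𝓞 K) K) Circle} {W W' : GL (Fin (n + 1)) (AdeleRing (𝓞 K) K) → ℂ}
    (T : Finset (HeightOneSpectrum (𝓞 K)))
    (hWN : ∀ v ∈ T, ∀ (u : GL (Fin (n + 1)) (v.adicCompletion K)) (hu : u ∈ upperUnitriangular (Fin (n + 1)) (v.adicCompletion K))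
      (g : GL (Fin (n + 1)) (AdeleRing (𝓞 K) K)),
      W (GLn.ofLocal (n + 1) K v u * g) = whittakerCharFun (ψ.adicComponent v) ⟨u, hu⟩ * W g)
    (hW'N : ∀ v ∈ T, ∀ (u : GL (Fin (n + 1)) (v.adicCompletion K)) (hu : u ∈ upperUnitriangular (Fin (n + 1)) (v.adicCompletion K))
      (g : GL (Fin (n + 1)) (AdeleRing (𝓞 K) K)),
      W' (GLn.ofLocal (n + 1) K v u * g) = whittakerCharFun (ψ.adicComponent v) ⟨u, hu⟩ * W' g)
    {t : ∀ v : HeightOneSpectrum (𝓞 K), Fin (n + 1) → (v.adicCompletion K)ˣ} {M c₀ m₀ : HeightOneSpectrum (𝓞 K) → ℤ}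
    (hW : ∀ v ∈ T, IsSpreadWhittakerAt v ψ (t v) (M v) W)
    (hψv : ∀ v ∈ T, ∃ x : v.adicCompletion K, Valued.v x ≤ exp (1 - c₀ v) ∧ ψ.adicComponent v x ≠ 1)
    (hM₁ : ∀ v ∈ T, 1 ≤ M v)
    (hmono : ∀ v ∈ T, ∀ i j : Fin (n + 1), i ≤ j → Valued.v (t v j : v.adicCompletion K) ≤ Valued.v (t v i : v.adicCompletion K))
    (hgap : ∀ v ∈ T, ∀ i j : Fin (n + 1), (i : ℕ) + 1 = j →
      exp (M v - c₀ v) * Valued.v (t v j : v.adicCompletion K) ≤ Valued.v (t v i : v.adicCompletion K))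
    (hmt : ∀ v ∈ T, exp (-m₀ v) * Valued.v (t v 0 : v.adicCompletion K) ≤ exp (-M v) * Valued.v (t v (Fin.last n) : v.adicCompletion K))
    (hW'K : ∀ v ∈ T, ∀ k ∈ valuedCongruenceSubgroup (Fin (n + 1)) (exp (-M v)), ∀ g : GL (Fin (n + 1)) (AdeleRing (𝓞 K) K),
      W' (g * GLn.ofLocal (n + 1) K v k) = W' g)
    {g : GL (Fin (n + 1)) (AdeleRing (𝓞 K) K)}
    (hlast : ∀ v ∈ T, ∀ j : Fin (n + 1),
      Valued.v (((localComponent v g : GL (Fin (n + 1)) (v.adicCompletion K)) :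
          Matrix (Fin (n + 1)) (Fin (n + 1)) (v.adicCompletion K)) (Fin.last n) j -
        if Fin.last n = j then 1 else 0) ≤ exp (-m₀ v))
    (hne : W g ≠ 0) :
    ∃ g' : GL (Fin (n + 1)) (AdeleRing (𝓞 K) K),
      (∀ v ∈ T, localComponent v g' = 1) ∧ (∀ w ∉ T, localComponent w g' = localComponent w g) ∧
      (∃ y ∈ Subgroup.closure (⋃ v ∈ T, Set.range (fun h : GL (Fin (n + 1)) (v.adicCompletion K) =>
          GLn.sndHom (n + 1) K (GLn.ofLocal (n + 1) K v h))),
        GLn.sndHom (n + 1) K g' = GLn.sndHom (n + 1) K g * y) ∧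
      W g * conj (W' g) = W g' * conj (W' g') ∧ W g' ≠ 0 := by
  classical
  -- induction on `T`, for all `g`
  induction T using Finset.induction_on generalizing g with
  | empty =>
    exact ⟨g, fun v hv => absurd hv (Finset.notMem_empty v), fun w _ => rfl, ⟨1, one_mem _, (mul_one _).symm⟩, rfl, hne⟩
  | insert v T hvT ih =>
    -- strip `v` first
    obtain ⟨u, hu, -, -, hprod, hne₁⟩ := apply_mul_conj_apply_eq_stripped (hWN v (Finset.mem_insert_self v T))
      (hW'N v (Finset.mem_insert_self v T)) (hW v (Finset.mem_insert_self v T)) (hψv v (Finset.mem_insert_self v T))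
      (hM₁ v (Finset.mem_insert_self v T)) (hmono v (Finset.mem_insert_self v T)) (hgap v (Finset.mem_insert_self v T))
      (hmt v (Finset.mem_insert_self v T)) (hW'K v (Finset.mem_insert_self v T)) (hlast v (Finset.mem_insert_self v T)) hne
    set g₁ : GL (Fin (n + 1)) (AdeleRing (𝓞 K) K) := g * GLn.ofLocal (n + 1) K v (localComponent v g)⁻¹ with hg₁
    have hg₁v : localComponent v g₁ = 1 := localComponent_mul_ofLocal_inv g
    have hg₁w : ∀ w, w ≠ v → localComponent w g₁ = localComponent w g := fun w hw => localComponent_stripped_of_ne hw g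
    -- then the places of `T`
    have hT : ∀ w ∈ T, w ∈ insert v T := fun w hw => Finset.mem_insert_of_mem hw
    have hlast₁ : ∀ w ∈ T, ∀ j : Fin (n + 1),
        Valued.v (((localComponent w g₁ : GL (Fin (n + 1)) (w.adicCompletion K)) :
            Matrix (Fin (n + 1)) (Fin (n + 1)) (w.adicCompletion K)) (Fin.last n) j -
          if Fin.last n = j then 1 else 0) ≤ exp (-m₀ w) := by
      intro w hw j
      have hwv : w ≠ v := fun h => hvT (h ▸ hw)
      rw [hg₁w w hwv]
      exact hlast w (hT w hw) j
    obtain ⟨g', hg'T, hg'off, ⟨y, hy, hg'f⟩, hprod', hne'⟩ :=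
      ih (fun w hw => hWN w (hT w hw)) (fun w hw => hW'N w (hT w hw)) (fun w hw => hW w (hT w hw))
        (fun w hw => hψv w (hT w hw)) (fun w hw => hM₁ w (hT w hw)) (fun w hw => hmono w (hT w hw))
        (fun w hw => hgap w (hT w hw)) (fun w hw => hmt w (hT w hw)) (fun w hw => hW'K w (hT w hw)) hlast₁ hne₁
    refine ⟨g', fun w hw => ?_, fun w hw => ?_, ⟨GLn.sndHom (n + 1) K (GLn.ofLocal (n + 1) K v (localComponent v g)⁻¹) * y, ?_, ?_⟩,
      by rw [hprod, hprod'], hne'⟩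
    · rcases Finset.mem_insert.1 hw with rfl | hw
      · rw [hg'off w hvT, hg₁v]
      · exact hg'T w hw
    · have hwv : w ≠ v := fun h => hw (h ▸ Finset.mem_insert_self v T)
      have hwT : w ∉ T := fun h => hw (Finset.mem_insert_of_mem h)
      rw [hg'off w hwT, hg₁w w hwv]
    · refine mul_mem (Subgroup.subset_closure ?_) (Subgroup.closure_mono ?_ hy)
      · refine Set.mem_iUnion₂.2 ⟨v, Finset.mem_insert_self v T, (localComponent v g)⁻¹, rfl⟩
      · exact Set.iUnion₂_subset fun w hw => Set.subset_iUnion₂_of_subset w (Finset.mem_insert_of_mem hw) subset_rfl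
    · rw [hg'f, hg₁, sndHom_stripped, mul_assoc]

end ManyPlaces

end Literature.NumberTheory.Automorphic
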